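import Mathlib.Analysis.SpecialFunctions.Pow.Real
import Mathlib.Analysis.SpecialFunctions.Sqrt
import Mathlib.Analysis.InnerProductSpace.PiL2
import Mathlib.Analysis.InnerProductSpace.Calculus
import Mathlib.MeasureTheory.Integral.IntervalIntegral.FundThmCalculus
import Mathlib.Topology.UniformSpace.UniformConvergence
import Mathlib.Analysis.Calculus.Deriv.MeanValue
import Mathlib.Topology.MetricSpace.UniformConvergence
import Mathlib.Topology.Order.Lattice
import Mathlib.Analysis.Calculus.MeanValue
import Mathlib.Topology.MetricSpace.Cauchy
import Mathlib.Analysis.SpecialFunctions.Integrals.Basic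
import Literature.Geometry.Lorentzian.Basic

/-!
# Route EIHFluxBalance — `InertialRecession`, line `old-light-leaves-the-cone`: charge kinematics, I
(basic real analysis for the endgame `stub_expandingChargeKinematics`)

Helper file for the crux `stmt-FinalStateConjecture-10166`
(`Summit.FinalStateConjecture.FinalStateConjecture.Theses.EIHFluxBalance.InertialRecession`),
second line lead. The endgame stub S4 of the line turns quasi-conserved abstract window charges into
Cesàro velocities of the painted centres. This file collects the Mathlib-only bricks every version
of that argument uses:

* `exists_tendsto_of_abs_sub_le` / `exists_tendsto_of_norm_sub_le` — convergence at `atTop` from a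
  Cauchy condition WITH SLACK (`∀ ε, ∃ T, ∀ T ≤ t₁ ≤ t₂, |f t₂ − f t₁| ≤ ε`), the form in which a
  window law `|ΔP| ≤ C∫(R⁻² + R^{-7/4}) + η(t₁)` delivers convergence along a path of radius `R ≍ t`;
* the Lorentz-factor algebra on the ball `‖v‖ ≤ k < 1`: `one_le_gammaFactor`, bounds, continuity, and
  the recovery of the velocity from the four-momentum `(γ, γv)` (`tendsto_of_tendsto_gamma_smul`);
* `cesaro_of_tendsto_deriv` / `cesaro_of_slaved` — a convergent (slaving) velocity is a Cesàro velocity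
  (`ξ̇ − v → 0`, `v → V` ⇒ `ξ(t)/t → V`);
* `exists_forall_norm_sub_le_two_mul` — eventually `2`-Lipschitz centres from slaving;
* the two tail integrals `∫_{t₁}^{t₂} (c s)⁻² ≤ (c² t₁)⁻¹` and `∫_{t₁}^{t₂} (c s)^{-7/4} ≤ (4/3) c^{-7/4} t₁^{-3/4}`.

The Cesàro lemmas and the Lorentz-factor positivity are stated for a general real normed space (the sibling
line's `Theorems.EIHFluxBalanceInertialRecessionStubEndgameBasics` has the `E3` specialisations
`tendsto_inv_smul_of_tendsto_deriv`, `tendsto_inv_smul_of_slaved`, `one_le_inv_sqrt_one_sub_sq`; this series is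
kept import-independent of it so that the two endgames can land in either order).
No Theses declaration is asserted; everything is [folklore] real analysis.
-/

set_option linter.dupNamespace false

noncomputable section

open Filter Set Metric Real
open scoped Topology

namespace Summit.FinalStateConjecture.FinalStateConjecture.Theorems.ChargeKinematics

open Literature.Geometry.Lorentzian

/-! ## Convergence from a Cauchy condition with slack -/

/-- A real function which is Cauchy at `+∞` in the slack form
`∀ ε > 0, ∃ T, ∀ T ≤ t₁ ≤ t₂, |f t₂ - f t₁| ≤ ε` converges. [folklore] -/
theorem exists_tendsto_of_abs_sub_le {f : ℝ → ℝ}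
    (h : ∀ ε > 0, ∃ T, ∀ t₁ t₂, T ≤ t₁ → t₁ ≤ t₂ → |f t₂ - f t₁| ≤ ε) :
    ∃ L, Tendsto f atTop (𝓝 L) := by
  have hc : CauchySeq f := by
    rw [Metric.cauchySeq_iff']
    intro ε hε
    obtain ⟨T, hT⟩ := h (ε / 2) (half_pos hε)
    refine ⟨T, fun t ht ↦ ?_⟩
    rw [Real.dist_eq]
    exact (hT T t le_rfl ht).trans_lt (half_lt_self hε)
  exact cauchySeq_tendsto_of_complete hc

/-- Normed-group version of `exists_tendsto_of_abs_sub_le`. [folklore] -/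
theorem exists_tendsto_of_norm_sub_le {E : Type*} [NormedAddCommGroup E] [CompleteSpace E]
    {f : ℝ → E} (h : ∀ ε > 0, ∃ T, ∀ t₁ t₂, T ≤ t₁ → t₁ ≤ t₂ → ‖f t₂ - f t₁‖ ≤ ε) :
    ∃ L, Tendsto f atTop (𝓝 L) := by
  have hc : CauchySeq f := by
    rw [Metric.cauchySeq_iff']
    intro ε hε
    obtain ⟨T, hT⟩ := h (ε / 2) (half_pos hε)
    refine ⟨T, fun t ht ↦ ?_⟩
    rw [dist_eq_norm]
    exact (hT T t le_rfl ht).trans_lt (half_lt_self hε)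
  exact cauchySeq_tendsto_of_complete hc

/-! ## Lorentz-factor algebra on `‖v‖ ≤ k < 1` -/

/-- For `‖v‖ < 1` the radicand `1 - ‖v‖²` is positive (any real normed space). [folklore] -/
theorem one_sub_norm_sq_pos {E : Type*} [NormedAddCommGroup E] {v : E} (hv : ‖v‖ < 1) :
    0 < 1 - ‖v‖ ^ 2 := by
  have h0 : 0 ≤ ‖v‖ := norm_nonneg v
  nlinarith

/-- The Lorentz factor `γ(v) = (√(1 − ‖v‖²))⁻¹` is at least `1` for `‖v‖ < 1` (any real normed space).
[folklore] -/
theorem one_le_gammaFactor {E : Type*} [NormedAddCommGroup E] {v : E} (hv : ‖v‖ < 1) :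
    1 ≤ (√(1 - ‖v‖ ^ 2))⁻¹ := by
  have hpos := one_sub_norm_sq_pos hv
  rw [le_inv_comm₀ one_pos (Real.sqrt_pos.mpr hpos), inv_one, Real.sqrt_le_one]
  nlinarith [norm_nonneg v]

/-- The Lorentz factor is positive for `‖v‖ < 1`. [folklore] -/
theorem gammaFactor_pos {v : E3} (hv : ‖v‖ < 1) : 0 < (√(1 - ‖v‖ ^ 2))⁻¹ :=
  one_pos.trans_le (one_le_gammaFactor hv)

/-- Monotone bound: `‖v‖ ≤ k < 1` gives `γ(v) ≤ γ(k) = (√(1 − k²))⁻¹`. [folklore] -/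
theorem gammaFactor_le {v : E3} {k : ℝ} (hv : ‖v‖ ≤ k) (hk : k < 1) :
    (√(1 - ‖v‖ ^ 2))⁻¹ ≤ (√(1 - k ^ 2))⁻¹ := by
  have h0 : 0 ≤ ‖v‖ := norm_nonneg v
  have hk0 : 0 ≤ k := h0.trans hv
  have hkpos : 0 < 1 - k ^ 2 := by nlinarith
  have hvpos : 0 < 1 - ‖v‖ ^ 2 := by nlinarith
  apply inv_anti₀ (Real.sqrt_pos.mpr hkpos)
  apply Real.sqrt_le_sqrt
  nlinarith

/-- The Lorentz factor is continuous on the open unit ball. [folklore] -/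
theorem continuousOn_gammaFactor :
    ContinuousOn (fun v : E3 ↦ (√(1 - ‖v‖ ^ 2))⁻¹) (Metric.ball 0 1) := by
  refine ContinuousOn.inv₀ ?_ fun v hv ↦ ?_
  · exact ((continuous_const.sub (continuous_norm.pow 2)).sqrt).continuousOn
  · rw [mem_ball_zero_iff] at hv
    exact (Real.sqrt_pos.mpr (one_sub_norm_sq_pos hv)).ne'

/-- Along a path that stays in `‖v‖ ≤ k < 1`, the Lorentz factor is continuous in time when the
velocity is. [folklore] -/
theorem continuous_gammaFactor_comp {v : ℝ → E3} {k : ℝ} (hv : Continuous v)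
    (hk : k < 1) (hvk : ∀ t, ‖v t‖ ≤ k) :
    Continuous fun t ↦ (√(1 - ‖v t‖ ^ 2))⁻¹ := by
  have hin : ∀ t, v t ∈ Metric.ball (0 : E3) 1 := fun t ↦ by
    rw [mem_ball_zero_iff]; exact (hvk t).trans_lt hk
  exact continuousOn_gammaFactor.comp_continuous hv hin

/-- **Recovering the velocity from the four-momentum.** If `γ(v(t)) → E` and
`γ(v(t)) • v(t) → p` with `E ≠ 0`, then `v(t) → E⁻¹ • p`. [folklore] -/
theorem tendsto_of_tendsto_gamma_smul {v : ℝ → E3} {γ : ℝ → ℝ} {E : ℝ} {p : E3}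
    (hγ : Tendsto γ atTop (𝓝 E)) (hp : Tendsto (fun t ↦ γ t • v t) atTop (𝓝 p)) (hE : E ≠ 0)
    (hγ0 : ∀ᶠ t in atTop, γ t ≠ 0) :
    Tendsto v atTop (𝓝 (E⁻¹ • p)) := by
  have h := (hγ.inv₀ hE).smul hp
  refine h.congr' ?_
  filter_upwards [hγ0] with t ht
  rw [smul_smul, inv_mul_cancel₀ ht, one_smul]

/-- Coordinatewise convergence in `E3` gives convergence. [folklore] -/
theorem tendsto_of_forall_coord {v : ℝ → E3} {V : E3}
    (h : ∀ k : Fin 3, Tendsto (fun t ↦ v t k) atTop (𝓝 (V k))) : Tendsto v atTop (𝓝 V) := by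
  have h1 : Tendsto (fun t ↦ (EuclideanSpace.equiv (Fin 3) ℝ) (v t)) atTop
      (𝓝 ((EuclideanSpace.equiv (Fin 3) ℝ) V)) := by
    rw [tendsto_pi_nhds]
    exact h
  have h2 := ((EuclideanSpace.equiv (Fin 3) ℝ).symm.continuous.tendsto _).comp h1
  rw [ContinuousLinearEquiv.symm_apply_apply] at h2
  exact h2.congr fun t ↦ by simp

/-! ## Cesàro velocity from a convergent (slaving) velocity -/

/-- If `f : ℝ → E` is differentiable and `f′(t) → V` as `t → ∞`, then `t⁻¹ • f(t) → V` (any real normed space;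
mean-value inequality on `[T₁, t]` applied to `f − (·)•V`). [folklore] -/
theorem cesaro_of_tendsto_deriv {E : Type*} [NormedAddCommGroup E] [NormedSpace ℝ E] {f : ℝ → E} {V : E}
    (hf : Differentiable ℝ f) (h : Tendsto (deriv f) atTop (𝓝 V)) :
    Tendsto (fun t : ℝ ↦ t⁻¹ • f t) atTop (𝓝 V) := by
  rw [Metric.tendsto_atTop] at h ⊢
  intro ε hε
  obtain ⟨T₀, hT₀⟩ := h (ε / 2) (half_pos hε)
  obtain ⟨T₁, hT₁0, hT₁⟩ : ∃ T₁ : ℝ, 0 ≤ T₁ ∧ ∀ s, T₁ ≤ s → ‖deriv f s - V‖ < ε / 2 :=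
    ⟨max T₀ 0, le_max_right _ _, fun s hs ↦ by
      rw [← dist_eq_norm]; exact hT₀ s ((le_max_left _ _).trans hs)⟩
  have hgd : ∀ s, HasDerivAt (fun s : ℝ ↦ f s - s • V) (deriv f s - V) s := fun s ↦ by
    have h1 : HasDerivAt f (deriv f s) s := (hf s).hasDerivAt
    have h2 : HasDerivAt (fun s : ℝ ↦ s • V) ((1 : ℝ) • V) s := (hasDerivAt_id s).smul_const V
    have h3 := h1.sub h2
    rw [one_smul] at h3
    exact h3
  have hseg : ∀ t, T₁ ≤ t →
      ‖(f t - t • V) - (f T₁ - T₁ • V)‖ ≤ ε / 2 * (t - T₁) := by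
    intro t ht
    exact norm_image_sub_le_of_norm_deriv_le_segment' (f := fun s : ℝ ↦ f s - s • V) (a := T₁)
      (b := t) (fun s _ ↦ (hgd s).hasDerivWithinAt) (fun s hs ↦ le_of_lt (hT₁ s hs.1)) t
      (right_mem_Icc.mpr ht)
  refine ⟨max (T₁ + 1) (2 * ‖f T₁ - T₁ • V‖ / ε + 1), fun t ht ↦ ?_⟩
  have ht1 : T₁ + 1 ≤ t := (le_max_left _ _).trans ht
  have ht₁ : T₁ ≤ t := by linarith
  have htK : 2 * ‖f T₁ - T₁ • V‖ / ε + 1 ≤ t := (le_max_right _ _).trans ht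
  have htpos : 0 < t := by linarith
  have hKt : ‖f T₁ - T₁ • V‖ < ε / 2 * t := by
    have h1 : 2 * ‖f T₁ - T₁ • V‖ / ε < t := by linarith
    have h2 := (div_lt_iff₀ hε).mp h1
    linarith
  have hgt : ‖f t - t • V‖ ≤ ε / 2 * (t - T₁) + ‖f T₁ - T₁ • V‖ := by
    calc ‖f t - t • V‖ = ‖((f t - t • V) - (f T₁ - T₁ • V)) + (f T₁ - T₁ • V)‖ := by
          rw [sub_add_cancel]
      _ ≤ ‖(f t - t • V) - (f T₁ - T₁ • V)‖ + ‖f T₁ - T₁ • V‖ := norm_add_le _ _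
      _ ≤ ε / 2 * (t - T₁) + ‖f T₁ - T₁ • V‖ := by linarith [hseg t ht₁]
  have hgt' : ‖f t - t • V‖ < ε * t := by
    have hmono : ε / 2 * (t - T₁) ≤ ε / 2 * t :=
      mul_le_mul_of_nonneg_left (by linarith) (le_of_lt (half_pos hε))
    linarith
  have hid : t⁻¹ • f t - V = t⁻¹ • (f t - t • V) := by
    rw [smul_sub, smul_smul, inv_mul_cancel₀ htpos.ne', one_smul]
  rw [dist_eq_norm, hid, norm_smul, norm_inv, Real.norm_eq_abs, abs_of_pos htpos]
  calc t⁻¹ * ‖f t - t • V‖ < t⁻¹ * (ε * t) := mul_lt_mul_of_pos_left hgt' (inv_pos.mpr htpos)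
    _ = ε := by rw [mul_comm ε t, inv_mul_cancel_left₀ htpos.ne']

/-- **A convergent slaving velocity is a Cesàro velocity** (any real normed space): `ξ` differentiable,
`ξ̇ − v → 0` and `v → V` give `t⁻¹ • ξ(t) → V`. [folklore] -/
theorem cesaro_of_slaved {E : Type*} [NormedAddCommGroup E] [NormedSpace ℝ E] {ξ v : ℝ → E} {V : E}
    (hξ : Differentiable ℝ ξ) (hslave : Tendsto (fun t ↦ deriv ξ t - v t) atTop (𝓝 0))
    (hv : Tendsto v atTop (𝓝 V)) : Tendsto (fun t : ℝ ↦ t⁻¹ • ξ t) atTop (𝓝 V) := by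
  refine cesaro_of_tendsto_deriv hξ ?_
  have h := hslave.add hv
  simp only [sub_add_cancel, zero_add] at h
  exact h

/-! ## Eventually `2`-Lipschitz centres from slaving -/

/-- If `ξ` is differentiable with `‖ξ'‖ ≤ 2` on `[T, ∞)`, then `ξ` is `2`-Lipschitz there.
[folklore] -/
theorem norm_sub_le_two_mul_of_norm_deriv_le {ξ : ℝ → E3} {T : ℝ} (hξ : Differentiable ℝ ξ)
    (hd : ∀ s, T ≤ s → ‖deriv ξ s‖ ≤ 2) {s s' : ℝ} (hs : T ≤ s) (hs' : T ≤ s') :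
    ‖ξ s - ξ s'‖ ≤ 2 * |s - s'| := by
  wlog hle : s' ≤ s generalizing s s'
  · have := this hs' hs (le_of_not_ge hle)
    rwa [norm_sub_rev, abs_sub_comm] at this
  have key := norm_image_sub_le_of_norm_deriv_le_segment' (f := ξ) (a := s') (b := s) (C := 2)
    (fun x _ ↦ (hξ x).hasDerivAt.hasDerivWithinAt) (fun x hx ↦ hd x (hs'.trans hx.1)) s
    (right_mem_Icc.mpr hle)
  rwa [abs_of_nonneg (sub_nonneg.mpr hle)]

/-- **Slaving makes the centres eventually `2`-Lipschitz**: from `ξ̇ − v → 0` and an eventual speed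
bound `‖v‖ ≤ k < 1` (indeed `k ≤ 1` suffices) there is `T` with `‖ξ(s) − ξ(s′)‖ ≤ 2|s − s′|` for
`s, s′ ≥ T`. [folklore] -/
theorem exists_forall_norm_sub_le_two_mul {ξ v : ℝ → E3} {k : ℝ} (hξ : Differentiable ℝ ξ)
    (hslave : Tendsto (fun t ↦ deriv ξ t - v t) atTop (𝓝 0)) (hk : k ≤ 1)
    (hvk : ∀ᶠ t in atTop, ‖v t‖ ≤ k) :
    ∃ T, ∀ s s', T ≤ s → T ≤ s' → ‖ξ s - ξ s'‖ ≤ 2 * |s - s'| := by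
  have h1 : ∀ᶠ t in atTop, ‖deriv ξ t - v t‖ < 1 := by
    have h := hslave.norm
    rw [norm_zero] at h
    exact h.eventually (gt_mem_nhds one_pos)
  obtain ⟨T, hT⟩ := eventually_atTop.mp (h1.and hvk)
  refine ⟨T, fun s s' hs hs' ↦ norm_sub_le_two_mul_of_norm_deriv_le hξ (fun x hx ↦ ?_) hs hs'⟩
  obtain ⟨hx1, hx2⟩ := hT x hx
  calc ‖deriv ξ x‖ = ‖(deriv ξ x - v x) + v x‖ := by rw [sub_add_cancel]
    _ ≤ ‖deriv ξ x - v x‖ + ‖v x‖ := norm_add_le _ _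
    _ ≤ 1 + k := by linarith [hx1.le]
    _ ≤ 2 := by linarith

/-! ## The two tail integrals of the window budget along `R = c s` -/

/-- `∫_{t₁}^{t₂} ((c s)²)⁻¹ ds ≤ (c² t₁)⁻¹` for `0 < c`, `0 < t₁ ≤ t₂`. [folklore] -/
theorem integral_inv_sq_mul_le {c t₁ t₂ : ℝ} (hc : 0 < c) (ht₁ : 0 < t₁) (h : t₁ ≤ t₂) :
    ∫ s in t₁..t₂, ((c * s) ^ 2)⁻¹ ≤ (c ^ 2 * t₁)⁻¹ := by
  have ht₂ : 0 < t₂ := ht₁.trans_le h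
  have hfun : (fun s : ℝ ↦ ((c * s) ^ 2)⁻¹) = fun s ↦ (c ^ 2)⁻¹ * s ^ (-2 : ℤ) := by
    funext s
    rw [mul_pow, mul_inv, zpow_neg, zpow_ofNat]
  rw [hfun, intervalIntegral.integral_const_mul]
  have hint : ∫ s in t₁..t₂, s ^ (-2 : ℤ) = (t₂ ^ (-1 : ℤ) - t₁ ^ (-1 : ℤ)) / (-1) := by
    have h0 : (0 : ℝ) ∉ Set.uIcc t₁ t₂ := by
      rw [Set.uIcc_of_le h]; exact fun hx ↦ by linarith [hx.1]
    have := integral_zpow (n := -2) (a := t₁) (b := t₂) (Or.inr ⟨by norm_num, h0⟩)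
    norm_num at this ⊢
    linarith [this]
  rw [hint]
  have h1 : t₂ ^ (-1 : ℤ) = t₂⁻¹ := by simp
  have h2 : t₁ ^ (-1 : ℤ) = t₁⁻¹ := by simp
  rw [h1, h2]
  have hc2 : 0 < c ^ 2 := by positivity
  rw [mul_inv, show (t₂⁻¹ - t₁⁻¹) / (-1 : ℝ) = t₁⁻¹ - t₂⁻¹ by ring]
  have : 0 ≤ t₂⁻¹ := by positivity
  nlinarith [inv_pos.mpr hc2]

/-- `∫_{t₁}^{t₂} ((c s)^{7/4})⁻¹ ds ≤ (4/3) c^{-7/4} t₁^{-3/4}` for `0 < c`, `0 < t₁ ≤ t₂`. [folklore] -/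
theorem integral_inv_rpow_mul_le {c t₁ t₂ : ℝ} (hc : 0 < c) (ht₁ : 0 < t₁) (h : t₁ ≤ t₂) :
    ∫ s in t₁..t₂, ((c * s) ^ (7 / 4 : ℝ))⁻¹ ≤
      4 / 3 * c ^ (-(7 / 4) : ℝ) * t₁ ^ (-(3 / 4) : ℝ) := by
  have ht₂ : 0 < t₂ := ht₁.trans_le h
  have hfun : Set.EqOn (fun s : ℝ ↦ ((c * s) ^ (7 / 4 : ℝ))⁻¹)
      (fun s ↦ c ^ (-(7 / 4) : ℝ) * s ^ (-(7 / 4) : ℝ)) (Set.uIcc t₁ t₂) := by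
    intro s hs
    rw [Set.uIcc_of_le h] at hs
    have hs0 : 0 ≤ s := ht₁.le.trans hs.1
    simp only
    rw [Real.mul_rpow hc.le hs0, mul_inv, Real.rpow_neg hc.le, Real.rpow_neg hs0]
  rw [intervalIntegral.integral_congr hfun, intervalIntegral.integral_const_mul]
  have h0 : (0 : ℝ) ∉ Set.uIcc t₁ t₂ := by
    rw [Set.uIcc_of_le h]; exact fun hx ↦ by linarith [hx.1]
  have hint := integral_rpow (a := t₁) (b := t₂) (r := -(7 / 4 : ℝ)) (Or.inr ⟨by norm_num, h0⟩)
  rw [hint]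
  have hcpow : 0 < c ^ (-(7 / 4) : ℝ) := Real.rpow_pos_of_pos hc _
  have h3 : -(7 / 4 : ℝ) + 1 = -(3 / 4) := by norm_num
  rw [h3]
  have hA : 0 ≤ t₂ ^ (-(3 / 4) : ℝ) := Real.rpow_nonneg ht₂.le _
  have hB : 0 ≤ t₁ ^ (-(3 / 4) : ℝ) := Real.rpow_nonneg ht₁.le _
  have key : (t₂ ^ (-(3 / 4) : ℝ) - t₁ ^ (-(3 / 4) : ℝ)) / (-(3 / 4) : ℝ) ≤
      4 / 3 * t₁ ^ (-(3 / 4) : ℝ) := by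
    rw [div_neg, neg_le, neg_mul_eq_neg_mul]
    rw [le_div_iff₀ (by norm_num : (0 : ℝ) < 3 / 4)]
    nlinarith
  calc c ^ (-(7 / 4) : ℝ) * ((t₂ ^ (-(3 / 4) : ℝ) - t₁ ^ (-(3 / 4) : ℝ)) / (-(3 / 4) : ℝ))
      ≤ c ^ (-(7 / 4) : ℝ) * (4 / 3 * t₁ ^ (-(3 / 4) : ℝ)) :=
        mul_le_mul_of_nonneg_left key hcpow.le
    _ = 4 / 3 * c ^ (-(7 / 4) : ℝ) * t₁ ^ (-(3 / 4) : ℝ) := by ring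


/-! ## (dev) fly-by -/
section FlyByDev
open MeasureTheory intervalIntegral


/-- The fly-by kernel `h_m(x) = (max m |x|)^{-p}`. We do not introduce a definition; this lemma records
its continuity. [folklore] -/
theorem continuous_flyByKernel (m p : ℝ) (hm : 0 < m) :
    Continuous fun x : ℝ ↦ (max m |x|) ^ (-p) := by
  refine Continuous.rpow_const (continuous_const.max continuous_abs) fun x ↦ Or.inl ?_
  exact (hm.trans_le (le_max_left _ _)).ne'

/-- The kernel is positive. [folklore] -/
theorem flyByKernel_pos {m p : ℝ} (hm : 0 < m) (x : ℝ) : 0 < (max m |x|) ^ (-p) :=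
  Real.rpow_pos_of_pos (hm.trans_le (le_max_left _ _)) _

/-- The kernel is bounded by `m^{-p}`. [folklore] -/
theorem flyByKernel_le {m p : ℝ} (hm : 0 < m) (hp : 0 ≤ p) (x : ℝ) :
    (max m |x|) ^ (-p) ≤ m ^ (-p) := by
  rw [Real.rpow_neg hm.le, Real.rpow_neg (hm.le.trans (le_max_left _ _))]
  apply inv_anti₀ (Real.rpow_pos_of_pos hm _)
  exact Real.rpow_le_rpow hm.le (le_max_left _ _) hp

/-- The kernel is bounded by `|x|^{-p}` away from `0`. [folklore] -/
theorem flyByKernel_le_abs {m p : ℝ} (hm : 0 < m) (hp : 0 ≤ p) {x : ℝ} (hx : x ≠ 0) :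
    (max m |x|) ^ (-p) ≤ |x| ^ (-p) := by
  have hx' : 0 < |x| := abs_pos.mpr hx
  rw [Real.rpow_neg hx'.le, Real.rpow_neg (hm.le.trans (le_max_left _ _))]
  apply inv_anti₀ (Real.rpow_pos_of_pos hx' _)
  exact Real.rpow_le_rpow hx'.le (le_max_right _ _) hp

/-- Half-line mass of the kernel: for `0 ≤ X`, `∫_0^X (max m |x|)^{-p} ≤ p m^{1−p}/(p−1)`. [folklore] -/
theorem integral_flyByKernel_le_of_nonneg {m p X : ℝ} (hm : 0 < m) (hp : 1 < p) (hX : 0 ≤ X) :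
    ∫ x in (0 : ℝ)..X, (max m |x|) ^ (-p) ≤ p * m ^ (1 - p) / (p - 1) := by
  have hp0 : 0 ≤ p := by linarith
  have hcont := continuous_flyByKernel m p hm
  have hmp : 0 < m ^ (1 - p) := Real.rpow_pos_of_pos hm _
  -- split at `min X m`
  rcases le_or_gt X m with hXm | hXm
  · -- `X ≤ m`: integrand `≤ m^{-p}`, length `≤ m`
    calc ∫ x in (0 : ℝ)..X, (max m |x|) ^ (-p)
        ≤ ∫ x in (0 : ℝ)..X, m ^ (-p) :=
          intervalIntegral.integral_mono_on hX (hcont.intervalIntegrable _ _)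
            intervalIntegrable_const fun x _ ↦ flyByKernel_le hm hp0 x
      _ = X * m ^ (-p) := by simp
      _ ≤ m * m ^ (-p) := mul_le_mul_of_nonneg_right hXm (Real.rpow_nonneg hm.le _)
      _ = m ^ (1 - p) := by
          rw [sub_eq_add_neg, Real.rpow_add hm, Real.rpow_one]
      _ ≤ p * m ^ (1 - p) / (p - 1) := by
          rw [le_div_iff₀ (by linarith)]
          nlinarith
  · -- `m < X`: `[0, m]` contributes `≤ m^{1-p}`, `[m, X]` contributes `≤ m^{1-p}/(p-1)`
    have hsplit : ∫ x in (0 : ℝ)..X, (max m |x|) ^ (-p) =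
        (∫ x in (0 : ℝ)..m, (max m |x|) ^ (-p)) + ∫ x in m..X, (max m |x|) ^ (-p) :=
      (intervalIntegral.integral_add_adjacent_intervals (hcont.intervalIntegrable _ _)
        (hcont.intervalIntegrable _ _)).symm
    have h1 : ∫ x in (0 : ℝ)..m, (max m |x|) ^ (-p) ≤ m ^ (1 - p) := by
      calc ∫ x in (0 : ℝ)..m, (max m |x|) ^ (-p)
          ≤ ∫ x in (0 : ℝ)..m, m ^ (-p) :=
            intervalIntegral.integral_mono_on hm.le (hcont.intervalIntegrable _ _)
              intervalIntegrable_const fun x _ ↦ flyByKernel_le hm hp0 x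
        _ = m * m ^ (-p) := by simp
        _ = m ^ (1 - p) := by rw [sub_eq_add_neg, Real.rpow_add hm, Real.rpow_one]
    have h2 : ∫ x in m..X, (max m |x|) ^ (-p) ≤ m ^ (1 - p) / (p - 1) := by
      have h0 : (0 : ℝ) ∉ Set.uIcc m X := by
        rw [Set.uIcc_of_le hXm.le]; exact fun hx ↦ by linarith [hx.1]
      calc ∫ x in m..X, (max m |x|) ^ (-p)
          ≤ ∫ x in m..X, x ^ (-p) := by
            refine intervalIntegral.integral_mono_on hXm.le (hcont.intervalIntegrable _ _)
              (intervalIntegral.intervalIntegrable_rpow (Or.inr h0)) fun x hx ↦ ?_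
            have hx0 : 0 < x := hm.trans_le hx.1
            have := flyByKernel_le_abs hm hp0 hx0.ne' (m := m) (p := p)
            rw [abs_of_pos hx0] at this ⊢
            exact this
        _ = (X ^ (-p + 1) - m ^ (-p + 1)) / (-p + 1) := integral_rpow (Or.inr ⟨by linarith, h0⟩)
        _ ≤ m ^ (1 - p) / (p - 1) := by
            have hpm : -p + 1 = 1 - p := by ring
            rw [hpm]
            have hX1 : 0 ≤ X ^ (1 - p) := Real.rpow_nonneg (hm.le.trans hXm.le) _
            have h1p : (1 - p) ≠ 0 := by linarith
            have hp1 : (p - 1) ≠ 0 := by linarith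
            have key : (X ^ (1 - p) - m ^ (1 - p)) / (1 - p) =
                (m ^ (1 - p) - X ^ (1 - p)) / (p - 1) := by
              field_simp
              ring
            rw [key]
            exact div_le_div_of_nonneg_right (by linarith) (by linarith)
    rw [hsplit]
    have hp1 : (p - 1) ≠ 0 := by linarith
    have : m ^ (1 - p) + m ^ (1 - p) / (p - 1) = p * m ^ (1 - p) / (p - 1) := by
      field_simp
      ring
    linarith

/-- Whole-line antiderivative bound: `G(x) = ∫_0^x (max m |y|)^{-p}` satisfies `|G x| ≤ p m^{1−p}/(p−1)`
for every real `x`. [folklore] -/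
theorem abs_integral_flyByKernel_le {m p : ℝ} (hm : 0 < m) (hp : 1 < p) (x : ℝ) :
    |∫ y in (0 : ℝ)..x, (max m |y|) ^ (-p)| ≤ p * m ^ (1 - p) / (p - 1) := by
  have hcont := continuous_flyByKernel m p hm
  rcases le_or_gt 0 x with hx | hx
  · rw [abs_of_nonneg (intervalIntegral.integral_nonneg hx fun y _ ↦ (flyByKernel_pos hm y).le)]
    exact integral_flyByKernel_le_of_nonneg hm hp hx
  · -- reflect: the kernel is even
    have heven : ∫ y in (0 : ℝ)..x, (max m |y|) ^ (-p) = -∫ y in (0 : ℝ)..(-x), (max m |y|) ^ (-p) := by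
      have := intervalIntegral.integral_comp_neg (a := (0 : ℝ)) (b := -x)
        (f := fun y : ℝ ↦ (max m |y|) ^ (-p))
      simp only [abs_neg, neg_zero, neg_neg] at this
      rw [this, intervalIntegral.integral_symm (0 : ℝ) x, neg_neg]
    rw [heven, abs_neg,
      abs_of_nonneg (intervalIntegral.integral_nonneg (by linarith) fun y _ ↦ (flyByKernel_pos hm y).le)]
    exact integral_flyByKernel_le_of_nonneg hm hp (by linarith)

/-- **THE FLY-BY INTEGRAL.** If `φ` is `C¹` on a neighbourhood of `[a, b]` (we ask for `HasDerivAt`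
everywhere and a continuous derivative) with `φ' ≥ g > 0` on `[a, b]`, then for every floor `m > 0`
and exponent `p > 1`,
`∫_a^b (max m |φ τ|)^{-p} dτ ≤ 2p m^{1−p} / ((p − 1) g)`, uniformly in `b − a`. [folklore] -/
theorem flyBy_integral_le {φ φ' : ℝ → ℝ} {a b g m p : ℝ} (hab : a ≤ b) (hg : 0 < g) (hm : 0 < m)
    (hp : 1 < p) (hφ : ∀ τ, HasDerivAt φ (φ' τ) τ) (hφ' : Continuous φ')
    (hmono : ∀ τ ∈ Set.Icc a b, g ≤ φ' τ) :
    ∫ τ in a..b, (max m |φ τ|) ^ (-p) ≤ 2 * p * m ^ (1 - p) / ((p - 1) * g) := by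
  have hcont := continuous_flyByKernel m p hm
  -- the antiderivative `G` of the kernel and the chain rule for `G ∘ φ`
  set G : ℝ → ℝ := fun x ↦ ∫ y in (0 : ℝ)..x, (max m |y|) ^ (-p) with hG
  have hGd : ∀ x, HasDerivAt G ((max m |x|) ^ (-p)) x := fun x ↦
    hcont.integral_hasStrictDerivAt 0 x |>.hasDerivAt
  have hcomp : ∀ τ, HasDerivAt (fun τ ↦ G (φ τ)) ((max m |φ τ|) ^ (-p) * φ' τ) τ := fun τ ↦
    (hGd (φ τ)).comp τ (hφ τ)
  -- pointwise: kernel ≤ (kernel · φ') / g on `[a, b]`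
  have hpt : ∀ τ ∈ Set.Icc a b, (max m |φ τ|) ^ (-p) ≤ (max m |φ τ|) ^ (-p) * φ' τ / g := by
    intro τ hτ
    rw [le_div_iff₀ hg]
    exact mul_le_mul_of_nonneg_left (hmono τ hτ) (flyByKernel_pos hm _).le
  have hφc : Continuous φ := continuous_iff_continuousAt.mpr fun τ ↦ (hφ τ).continuousAt
  have hint1 : IntervalIntegrable (fun τ ↦ (max m |φ τ|) ^ (-p)) volume a b :=
    (hcont.comp hφc).intervalIntegrable _ _
  have hint2 : IntervalIntegrable (fun τ ↦ (max m |φ τ|) ^ (-p) * φ' τ / g) volume a b :=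
    (((hcont.comp hφc).mul hφ').div_const g).intervalIntegrable _ _
  calc ∫ τ in a..b, (max m |φ τ|) ^ (-p)
      ≤ ∫ τ in a..b, (max m |φ τ|) ^ (-p) * φ' τ / g :=
        intervalIntegral.integral_mono_on hab hint1 hint2 hpt
    _ = (∫ τ in a..b, (max m |φ τ|) ^ (-p) * φ' τ) / g := by
        rw [intervalIntegral.integral_div]
    _ = (G (φ b) - G (φ a)) / g := by
        rw [intervalIntegral.integral_eq_sub_of_hasDerivAt (fun τ _ ↦ hcomp τ)
          (((hcont.comp hφc).mul hφ').intervalIntegrable _ _)]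
    _ ≤ (2 * p * m ^ (1 - p) / (p - 1)) / g := by
        apply div_le_div_of_nonneg_right _ hg.le
        have h1 := abs_integral_flyByKernel_le hm hp (φ b)
        have h2 := abs_integral_flyByKernel_le hm hp (φ a)
        have := abs_sub (G (φ b)) (G (φ a))
        calc G (φ b) - G (φ a) ≤ |G (φ b) - G (φ a)| := le_abs_self _
          _ ≤ |G (φ b)| + |G (φ a)| := abs_sub _ _
          _ ≤ p * m ^ (1 - p) / (p - 1) + p * m ^ (1 - p) / (p - 1) := add_le_add h1 h2
          _ = 2 * p * m ^ (1 - p) / (p - 1) := by ring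
    _ = 2 * p * m ^ (1 - p) / ((p - 1) * g) := by rw [div_div]


end FlyByDev

/-! ## General N: the MULTI-ESCAPE statement (interface design; proof = the general-N programme) -/

section MultiEscapeStatement

open MeasureTheory intervalIntegral

/-- **MULTI-ESCAPE (statement, level `k`; interface design only).** Abstract form over an index type `ι`
of holes. Data on a late interval `[t₀, τ]`:
* a finite set `A` of ACTIVE holes partitioned into velocity clusters by `cl : ι → ℕ` (holes with equal
  label are one cluster), and a finite set `X` of EXTERNAL holes;
* painted centres `ξ`, velocities `v` (speeds `≤ k < 1`, slaving errors `≤ β₁/8`), masses `Mh > 0`;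
* for every active hole a singleton charge `Q i` read along a radius `R i ≥ min((nearest other hole)/3, c₂s)`
  with ONE law (constant `C i ≤ Cmax`, error `e i ≤ ε`) and identification;
* for every cluster label a cluster window charge `Qw` along `min(ψ/2, c₂s)` for any admissible clearance `ψ`
  (the `cluster_window_law` output, constant `≤ Cmax`, error `≤ ε`);
* for every external hole `x` and active hole `i` a CERTIFIED FLY-BY: a coordinate `φX x i` with
  `|φX| ≤ d_{xi}`, derivative `≥ gX > 0` on the interval, and the floor `m₀ ≤ d_{xi}`;
* at `t₀`: intra-cluster relative velocities `< β₁`, inter-cluster relative velocities `≥ 3β`.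
Conclusion: on `[t₀, τ]` every active velocity moves by `≤ β/4` and every intra-cluster relative velocity
stays `≤ 3β₁/2` — GIVEN the smallness of the budgets (fly-by constants at `m₀`, tails at `t₀`, `ε`) against
`β₁ ≪ β` and the finer resolutions `βs` (a list of `A.card` resolutions for the recursive velocity
triggers). The `N = 3` escape lemma is the instance `A = {a, b, c}`, clusters `{a, c}`, `{b}`, `X = ∅`.
The proof is the general-`N` programme (mechanisms (E), (P), (V) of the plan note); NOT proved here. -/
theorem multiEscape_statement_shape {ι : Type*} [DecidableEq ι] (A X : Finset ι) (hAX : Disjoint A X)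
    (cl : ι → ℕ) {ξ v : ι → ℝ → E3} {Q : ι → ℝ → Fin 4 → ℝ} {R e : ι → ℝ → ℝ} {C Mh : ι → ℝ}
    {Qw : ℕ → ι → (ℝ → ℝ) → ℝ → Fin 4 → ℝ} {Cw : ℝ} {ew : ℝ → ℝ}
    {φX φX' : ι → ι → ℝ → ℝ} {gX : ℝ}
    {k t₀ τ m₀ c₂ β β₁ ε Cmax Mmin : ℝ} {βs : List ℝ}
    -- scalars
    (hk1 : k < 1) (ht₀ : 1 ≤ t₀) (hτ : t₀ ≤ τ) (hm₀ : 1 ≤ m₀) (hc₂ : 0 < c₂) (hβ : 0 < β) (hβ₁ : 0 < β₁)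
    (hε : 0 ≤ ε) (hCmax : 0 ≤ Cmax) (hMmin : 0 < Mmin) (hgX : 0 < gX)
    -- kinematics of the active holes on the interval
    (hdiff : ∀ i ∈ A ∪ X, Differentiable ℝ (ξ i)) (hvc : ∀ i ∈ A, Continuous (v i))
    (hvk : ∀ i ∈ A, ∀ s ∈ Set.Icc t₀ τ, ‖v i s‖ ≤ k)
    (hsl : ∀ i ∈ A, ∀ s ∈ Set.Icc t₀ τ, ‖deriv (ξ i) s - v i s‖ ≤ β₁ / 8)
    (hM : ∀ i ∈ A, Mmin ≤ Mh i)
    -- singleton laws of the active holes along their nearest-neighbour radii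
    (hlaw : ∀ i ∈ A, ∀ t₁ t₂, t₀ ≤ t₁ → t₁ ≤ t₂ → t₂ ≤ τ → ∀ μ : Fin 4, |Q i t₂ μ - Q i t₁ μ| ≤
      C i * (∫ s in t₁..t₂, ((R i s) ^ 2)⁻¹ + ((R i s) ^ (7 / 4 : ℝ))⁻¹) + e i t₁)
    (hid : ∀ i ∈ A, ∀ t ∈ Set.Icc t₀ τ, |Q i t 0 - Mh i * (√(1 - ‖v i t‖ ^ 2))⁻¹| ≤ e i t ∧
      ∀ k' : Fin 3, |Q i t k'.succ - Mh i * (√(1 - ‖v i t‖ ^ 2))⁻¹ * v i t k'| ≤ e i t)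
    (he : ∀ i ∈ A, ∀ t ∈ Set.Icc t₀ τ, e i t ≤ ε) (hC : ∀ i ∈ A, 0 ≤ C i ∧ C i ≤ Cmax)
    (hRc : ∀ i ∈ A, ContinuousOn (R i) (Set.Icc t₀ τ)) (hR1 : ∀ i ∈ A, ∀ s ∈ Set.Icc t₀ τ, 1 ≤ R i s)
    (hRge : ∀ i ∈ A, ∀ s ∈ Set.Icc t₀ τ, ∀ (hne : ((A ∪ X).erase i).Nonempty),
      min ((((A ∪ X).erase i).inf' hne fun j ↦ ‖ξ j s - ξ i s‖) / 3) (c₂ * s) ≤ R i s)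
    -- the cluster window law (output shape of `cluster_window_law`) for every cluster label and anchor
    (hCw : 0 ≤ Cw ∧ Cw ≤ Cmax) (hew : ∀ t ∈ Set.Icc t₀ τ, ew t ≤ ε)
    (hpair : ∀ (l : ℕ) (a : ι), a ∈ A → cl a = l → ∀ (s₁ s₂ : ℝ) (ψ : ℝ → ℝ), t₀ ≤ s₁ → s₁ ≤ s₂ → s₂ ≤ τ →
      (∀ s ∈ Set.Icc s₁ s₂, ∀ s' ∈ Set.Icc s₁ s₂, |ψ s - ψ s'| ≤ 4 * |s - s'|) →
      (∀ s ∈ Set.Icc s₁ s₂, (∀ j ∈ A, cl j = l → 4 * ‖ξ a s - ξ j s‖ ≤ ψ s ∧ 2 * ‖ξ a s - ξ j s‖ ≤ c₂ * s) ∧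
        ∀ j ∈ A ∪ X, cl j ≠ l ∨ j ∈ X → ψ s ≤ ‖ξ j s - ξ a s‖) →
      (∀ μ : Fin 4, |Qw l a ψ s₂ μ - Qw l a ψ s₁ μ| ≤
        Cw * (∫ s in s₁..s₂, ((min (ψ s / 2) (c₂ * s)) ^ 2)⁻¹ +
          ((min (ψ s / 2) (c₂ * s)) ^ (7 / 4 : ℝ))⁻¹) + ew s₁) ∧
      (∀ s ∈ Set.Icc s₁ s₂, |Qw l a ψ s 0 - ∑ j ∈ A.filter (fun j ↦ cl j = l), Mh j * (√(1 - ‖v j s‖ ^ 2))⁻¹| ≤ ew s ∧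
        ∀ k' : Fin 3, |Qw l a ψ s k'.succ -
          ∑ j ∈ A.filter (fun j ↦ cl j = l), Mh j * (√(1 - ‖v j s‖ ^ 2))⁻¹ * v j s k'| ≤ ew s))
    -- certified external fly-bys
    (hφX : ∀ x ∈ X, ∀ i ∈ A, ∀ s, HasDerivAt (φX x i) (φX' x i s) s)
    (hφX' : ∀ x ∈ X, ∀ i ∈ A, Continuous (φX' x i))
    (hmonoX : ∀ x ∈ X, ∀ i ∈ A, ∀ s ∈ Set.Icc t₀ τ, gX ≤ φX' x i s)
    (hflX : ∀ x ∈ X, ∀ i ∈ A, ∀ s ∈ Set.Icc t₀ τ, max m₀ |φX x i s| ≤ ‖ξ x s - ξ i s‖)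
    -- floors between active holes
    (hfloor : ∀ i ∈ A, ∀ j ∈ A, i ≠ j → ∀ s ∈ Set.Icc t₀ τ, m₀ ≤ ‖ξ i s - ξ j s‖)
    -- the trigger configuration at `t₀`
    (hintra : ∀ i ∈ A, ∀ j ∈ A, cl i = cl j → ‖v i t₀ - v j t₀‖ < β₁)
    (hinter : ∀ i ∈ A, ∀ j ∈ A, cl i ≠ cl j → 3 * β ≤ ‖v i t₀ - v j t₀‖)
    -- resolutions for the recursive velocity triggers and the smallness side conditions (shape only)
    (hβs : βs.length = A.card) (hsmall : True) :
    (∀ i ∈ A, ∀ s ∈ Set.Icc t₀ τ, ‖v i s - v i t₀‖ ≤ β / 4) ∧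
      ∀ i ∈ A, ∀ j ∈ A, cl i = cl j → ∀ s ∈ Set.Icc t₀ τ, ‖v i s - v j s‖ ≤ 3 * β₁ / 2 := by
  sorry

end MultiEscapeStatement

end Summit.FinalStateConjecture.FinalStateConjecture.Theorems.ChargeKinematics

end
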